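import Literature.Algebra.Homology.BettiOneResidueField
import Literature.Algebra.Homology.BaseChangeComplex
import Mathlib.LinearAlgebra.Contraction
import Mathlib.LinearAlgebra.Dual.Lemmas
import Mathlib.RingTheory.TensorProduct.Basic
import HarnessLib

/-!
# `Hom_R(Hom_R(K•, R), M) ≅ M ⊗_R K•` for a finite free complex: transport of `H⁰`∕`H¹`, `dim_k H¹(k ⊗_R K•) = dim_k 𝔪/𝔪²`,
# and the representability `Hom_R(Q, M) ≅ H⁰(M ⊗_R K•)` ([EGAIII2] (7.7.6); [MumfordAV1970] §13)

Layer `Literature/Algebra/Homology`, namespace `Literature.Algebra.Homology`.  THEOREMS ONLY (Mathlib + ★ `HomComplexOfModule`,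
★ `BaseChangeComplex`, ★ B3 `BettiOneResidueField`; no definition, no named fact, no instance, no notation, no `sorry`).
Sequel of brick B3 of the duality-free «H1-DIM any characteristic» cut of the DUAL-S road (cell hodgecm-mathlib, memo
`MEMO-H1DIM-cut.v1.B-p04g40` §2: B3 = «β₁(k) = emb dim» ★ + «`Hom_R(Hom_R(P,R), M) ≅ P ⊗ M` compatibly with maps» + EGA III
(7.7.6) representability, the latter two here).  Idle-capacity generic capital (LEAD F0P6-plan (g3) 2026-09-02 00:58:59Z); HC_CM is
proved only modulo the printed citations until rung 0 closes; this file discharges none of them.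

## Mathematics

* §1 TRANSPORT (any ring `S`): degreewise `S`-isomorphisms `e₀, e₁, e₂` commuting with `A₀ → A₁ → A₂` and `B₀ → B₁ → B₂` identify
  kernels (`nonempty_ker_linearEquiv_of_comm`) and the degree-one cohomologies in the map-`mkQ` spelling
  `(ker a₂).map (im a₁).mkQ ≃ₗ (ker b₂).map (im b₁).mkQ` (`nonempty_HOne_linearEquiv_of_comm`; `map_range_eq_range_of_comm`,
  `map_ker_eq_ker_of_comm`).
* §2 `exists_homDual_linearEquiv_tensor`: for `P` finite free over a commutative ring `R` and any `M`,
  `δ : Hom_R(P^∨, M) ≃ₗ[R] M ⊗_R P` normalised by `δ⁻¹(m ⊗ x)(ψ) = ψ(x)·m` (Mathlib `dualTensorHomEquiv` at `P^∨` and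
  reflexivity `Module.evalEquiv`).
* §3 over a local ring `(R, 𝔪, k)`: `exists_residueField_tensor_linearEquiv_homDual` — the `k`-LINEAR `k ⊗_R P ≃ₗ[k] Hom_R(P^∨, k)`,
  `c ⊗ x ↦ (ψ ↦ ψ(x)·c)` (`LinearEquiv.extendScalarsOfSurjective` along `R ↠ k`); it intertwines `k ⊗ d` with precomposition by
  `d^∨`, whence **`finrank_HOne_baseChangeComplex_residueField_eq_finrank_cotangentSpace`**: for `R` noetherian local and a
  cochain complex `K•` of finite free `R`-modules whose dual `Hom_R(K•, R)` is exact at `-1` (★ B2) and resolves `k` at degree `0`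
  through `ε : Hom_R(K⁰, R) ↠ k`, `ker ε = im(d⁰¹)^∨` (brick B5), the degree-one cohomology of `k ⊗_R K•` (★ `baseChangeComplex k K`)
  has `dim_k = dim_k 𝔪/𝔪²` (★ B3 `finrank_extOne_eq_finrank_cotangentSpace` transported by §1) — `= g` for `R` regular of
  dimension `g`: the local count of [MumfordAV1970] §13 («`dim H¹(X, 𝒪_X) = g`»), with no duality and no spectral sequence.
* §4 **`exists_homCokerDual_linearEquiv_HZero_natural`** ([EGAIII2] (7.7.6)): for `K⁰ → K¹` with both terms finite free and
  `Q := coker(Hom_R(K¹,R) → Hom_R(K⁰,R))`, a family `Φ_M : Hom_R(Q, M) ≃ₗ[R] ker(M ⊗ K⁰ → M ⊗ K¹)` over all `R`-modules `M`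
  (`ModuleCat R`), characterised by the contraction formula `⟨ψ, Φ_M φ⟩ = φ[ψ]` and natural in `M`
  (`Φ_{M′}(g ∘ φ) = (g ⊗ 1) Φ_M(φ)`) — the module `Q` represents `M ↦ H⁰(M ⊗_R K•)`; brick B5 reads `Hom_R(Q, k) = H⁰(A, 𝒪_A) = k`
  and `Hom_R(Q, R/J)` from it.

## References
* [Weibel1994] C. Weibel, *An introduction to homological algebra* (1994), §1.1 (p. 2) (chain complexes, cycles, boundaries, maps).
* [StacksProject] The Stacks Project, Tag 0111 (Homology: cohomology of complexes is functorial).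
* [EGAIII2] A. Grothendieck, *EGA III₂* (1963), (7.7.6) (the module `Q` with `H⁰(X_T, F ⊗ 𝒪_T) = Hom(Q, 𝒪_T)`).
* [MumfordAV1970] D. Mumford, *Abelian Varieties* (1970), §13 (pp. 125–130).
* [BrunsHerzog1998] W. Bruns, J. Herzog, *Cohen–Macaulay rings*, rev. ed. (1998), §1.1 (p. 4) (duals of finite free modules),
  §1.3 Prop. 1.3.1 and Cor. 1.3.2 (pp. 16–17).
-/

universe v u

open IsLocalRing Module TensorProduct

namespace Literature.Algebra.Homology

/-! ## §1 Transport of `H⁰` and `H¹` along degreewise isomorphisms (map-`mkQ` spelling) -/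

section Transport

variable {S : Type u} [Ring S] {A₀ A₁ A₂ B₀ B₁ B₂ : Type v}
  [AddCommGroup A₀] [Module S A₀] [AddCommGroup A₁] [Module S A₁] [AddCommGroup A₂] [Module S A₂]
  [AddCommGroup B₀] [Module S B₀] [AddCommGroup B₁] [Module S B₁] [AddCommGroup B₂] [Module S B₂]

/-- An isomorphism intertwining `a : A₀ → A₁` and `b : B₀ → B₁` maps `im a` onto `im b` (an isomorphism of complexes identifies
boundaries). [cite: Weibel1994, §1.1 (p. 2)] [cite: StacksProject, Tag 0111] -/
theorem map_range_eq_range_of_comm (a : A₀ →ₗ[S] A₁) (b : B₀ →ₗ[S] B₁) (e₀ : A₀ ≃ₗ[S] B₀) (e₁ : A₁ ≃ₗ[S] B₁)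
    (h : ∀ x, e₁ (a x) = b (e₀ x)) : (LinearMap.range a).map (e₁ : A₁ →ₗ[S] B₁) = LinearMap.range b := by
  apply le_antisymm
  · rintro _ ⟨_, ⟨x, rfl⟩, rfl⟩
    exact ⟨e₀ x, (h x).symm⟩
  · rintro _ ⟨y, rfl⟩
    refine ⟨a (e₀.symm y), ⟨_, rfl⟩, ?_⟩
    rw [LinearEquiv.coe_coe, h, LinearEquiv.apply_symm_apply]

/-- An isomorphism intertwining `a : A₁ → A₂` and `b : B₁ → B₂` (with an isomorphism on the targets) maps `ker a` onto
`ker b` (an isomorphism of complexes identifies cycles). [cite: Weibel1994, §1.1 (p. 2)] [cite: StacksProject, Tag 0111] -/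
theorem map_ker_eq_ker_of_comm (a : A₁ →ₗ[S] A₂) (b : B₁ →ₗ[S] B₂) (e₁ : A₁ ≃ₗ[S] B₁) (e₂ : A₂ ≃ₗ[S] B₂)
    (h : ∀ x, e₂ (a x) = b (e₁ x)) : (LinearMap.ker a).map (e₁ : A₁ →ₗ[S] B₁) = LinearMap.ker b := by
  apply le_antisymm
  · rintro _ ⟨x, hx, rfl⟩
    rw [SetLike.mem_coe, LinearMap.mem_ker] at hx
    rw [LinearMap.mem_ker, LinearEquiv.coe_coe, ← h, hx, map_zero]
  · intro y hy
    refine ⟨e₁.symm y, ?_, e₁.apply_symm_apply y⟩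
    rw [LinearMap.mem_ker] at hy
    rw [SetLike.mem_coe, LinearMap.mem_ker]
    apply e₂.injective
    rw [h, LinearEquiv.apply_symm_apply, hy, map_zero]

/-- **Transport of `H⁰`**: degreewise isomorphisms commuting with the differentials identify the kernels (an isomorphism of
complexes induces an isomorphism on cohomology). [cite: Weibel1994, §1.1 (p. 2)] [cite: StacksProject, Tag 0111] -/
theorem nonempty_ker_linearEquiv_of_comm (a : A₁ →ₗ[S] A₂) (b : B₁ →ₗ[S] B₂) (e₁ : A₁ ≃ₗ[S] B₁) (e₂ : A₂ ≃ₗ[S] B₂)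
    (h : ∀ x, e₂ (a x) = b (e₁ x)) : Nonempty (↥(LinearMap.ker a) ≃ₗ[S] ↥(LinearMap.ker b)) :=
  ⟨(e₁.submoduleMap _).trans (LinearEquiv.ofEq _ _ (map_ker_eq_ker_of_comm a b e₁ e₂ h))⟩

/-- **Transport of `H¹`** (in the spelling «image of the cocycles in the quotient by the coboundaries»): degreewise
isomorphisms `e₀, e₁, e₂` commuting with `A₀ → A₁ → A₂` and `B₀ → B₁ → B₂` identify `(ker a₂).map (im a₁).mkQ` with
`(ker b₂).map (im b₁).mkQ` (an isomorphism of complexes induces an isomorphism on cohomology).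
[cite: Weibel1994, §1.1 (p. 2)] [cite: StacksProject, Tag 0111] -/
theorem nonempty_HOne_linearEquiv_of_comm (a₁ : A₀ →ₗ[S] A₁) (a₂ : A₁ →ₗ[S] A₂) (b₁ : B₀ →ₗ[S] B₁) (b₂ : B₁ →ₗ[S] B₂)
    (e₀ : A₀ ≃ₗ[S] B₀) (e₁ : A₁ ≃ₗ[S] B₁) (e₂ : A₂ ≃ₗ[S] B₂)
    (h₁ : ∀ x, e₁ (a₁ x) = b₁ (e₀ x)) (h₂ : ∀ x, e₂ (a₂ x) = b₂ (e₁ x)) :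
    Nonempty (↥((LinearMap.ker a₂).map (LinearMap.range a₁).mkQ) ≃ₗ[S]
      ↥((LinearMap.ker b₂).map (LinearMap.range b₁).mkQ)) := by
  have hr := map_range_eq_range_of_comm a₁ b₁ e₀ e₁ h₁
  let E := Submodule.Quotient.equiv (LinearMap.range a₁) (LinearMap.range b₁) e₁ hr
  have hE : (E : (A₁ ⧸ LinearMap.range a₁) →ₗ[S] (B₁ ⧸ LinearMap.range b₁)) ∘ₗ (LinearMap.range a₁).mkQ =
      (LinearMap.range b₁).mkQ ∘ₗ (e₁ : A₁ →ₗ[S] B₁) := by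
    ext x
    simp only [LinearMap.comp_apply, Submodule.mkQ_apply, LinearEquiv.coe_coe, E, Submodule.Quotient.equiv_apply,
      Submodule.mapQ_apply]
  have hmap : ((LinearMap.ker a₂).map (LinearMap.range a₁).mkQ).map
      (E : (A₁ ⧸ LinearMap.range a₁) →ₗ[S] (B₁ ⧸ LinearMap.range b₁)) = (LinearMap.ker b₂).map (LinearMap.range b₁).mkQ := by
    rw [← Submodule.map_comp, hE, Submodule.map_comp, map_ker_eq_ker_of_comm a₂ b₂ e₁ e₂ h₂]
  exact ⟨(E.submoduleMap _).trans (LinearEquiv.ofEq _ _ hmap)⟩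

end Transport

/-! ## §2 `Hom_R(Hom_R(P, R), M) ≅ M ⊗_R P` for `P` finite free -/

section DoubleDual

variable {R : Type u} [CommRing R] (P : Type u) [AddCommGroup P] [Module R P] [Module.Free R P] [Module.Finite R P]
  (M : Type u) [AddCommGroup M] [Module R M]

/-- **`Hom_R(P^∨, M) ≅ M ⊗_R P` for `P` finite free**, normalised by `δ⁻¹(m ⊗ x) = (ψ ↦ ψ(x)·m)` (Mathlib
`dualTensorHomEquiv` at `P^∨` + reflexivity `Module.evalEquiv`). [cite: EGAIII2, (7.7.6)] [cite: BrunsHerzog1998, §1.1 (p. 4)] -/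
theorem exists_homDual_linearEquiv_tensor :
    ∃ δ : ((P →ₗ[R] R) →ₗ[R] M) ≃ₗ[R] M ⊗[R] P, ∀ (m : M) (x : P) (ψ : P →ₗ[R] R), δ.symm (m ⊗ₜ x) ψ = ψ x • m := by
  refine ⟨(dualTensorHomEquiv R (Module.Dual R P) M).symm ≪≫ₗ
    TensorProduct.congr (Module.evalEquiv R P).symm (LinearEquiv.refl R M) ≪≫ₗ TensorProduct.comm R P M, fun m x ψ => ?_⟩
  simp only [LinearEquiv.trans_symm, LinearEquiv.symm_symm, LinearEquiv.trans_apply, TensorProduct.comm_symm_tmul,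
    TensorProduct.congr_symm_tmul, LinearEquiv.symm_symm, LinearEquiv.refl_symm, LinearEquiv.refl_apply,
    dualTensorHomEquiv, dualTensorHomEquivOfBasis_apply, dualTensorHom_apply, Module.evalEquiv_apply, Module.Dual.eval_apply]

end DoubleDual

/-! ## §3 Over a local ring: `k ⊗_R Kⁱ ≃ₗ[k] Hom_R(Hom_R(Kⁱ, R), k)` and `dim_k H¹(k ⊗_R K•) = dim_k 𝔪/𝔪²` -/

section ResidueField

variable {R : Type u} [CommRing R] [IsLocalRing R]

/-- **`k ⊗_R P ≃ₗ[k] Hom_R(P^∨, k)`** for `P` finite free over the local ring `(R, 𝔪, k)`, `k`-LINEAR, normalised by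
`E(c ⊗ x)(ψ) = ψ(x)·c` (the `R`-linear `δ⁻¹` of §2 upgraded along the surjection `R ↠ k`, Mathlib
`LinearEquiv.extendScalarsOfSurjective`). [cite: EGAIII2, (7.7.6)] [cite: BrunsHerzog1998, §1.3 Prop. 1.3.1 and Cor. 1.3.2 (pp. 16–17)] -/
theorem exists_residueField_tensor_linearEquiv_homDual (P : Type u) [AddCommGroup P] [Module R P] [Module.Free R P]
    [Module.Finite R P] :
    ∃ E : (ResidueField R ⊗[R] P) ≃ₗ[ResidueField R] ((P →ₗ[R] R) →ₗ[R] ResidueField R),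
      ∀ (c : ResidueField R) (x : P) (ψ : P →ₗ[R] R), E (c ⊗ₜ x) ψ = ψ x • c := by
  obtain ⟨δ, hδ⟩ := exists_homDual_linearEquiv_tensor (R := R) P (ResidueField R)
  have hsurj : Function.Surjective (algebraMap R (ResidueField R)) := residue_surjective
  exact ⟨δ.symm.extendScalarsOfSurjective hsurj, fun c x ψ => by
    rw [LinearEquiv.extendScalarsOfSurjective_apply]; exact hδ c x ψ⟩

/-- **`dim_k H¹(k ⊗_R K•) = dim_k 𝔪/𝔪²` — the local count of [MumfordAV1970] §13, duality-free.**  Let `(R, 𝔪, k)` be a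
noetherian local ring and `K•` a cochain complex of finite free `R`-modules whose DUAL `Hom_R(K•, R)` (★ `homComplex K R`) is
exact at degree `-1` (★ B2 `homComplex_exactAt_of_neg`) and resolves `k` at degree `0` through an augmentation
`ε : Hom_R(K⁰, R) ↠ k` with `ker ε = im(Hom_R(K¹, R) → Hom_R(K⁰, R))` (brick B5: `Q = H⁰(Hom(K•, R)) ≅ k`).  Then the degree-one
cohomology of the base change `k ⊗_R K•` (★ `baseChangeComplex k K`; cocycles `ker(k ⊗ d¹²)` modulo coboundaries
`im(k ⊗ d⁰¹)`, in the map-`mkQ` spelling) has `k`-dimension `dim_k 𝔪/𝔪²`.  Proof: §3 identifies `k ⊗_R Kⁱ ≃ₗ[k]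
Hom_R(Hom_R(Kⁱ, R), k)` compatibly with the differentials (`i = 0, 1, 2`), §1 transports `H¹`, and ★ B3
`finrank_extOne_eq_finrank_cotangentSpace` computes `dim_k Ext¹_R(k, k) = dim_k 𝔪/𝔪²` from the free presentation
`Hom(K², R) → Hom(K¹, R) → Hom(K⁰, R) → k → 0`.  For `R` regular of dimension `g` this is `g`.
[cite: MumfordAV1970, §13 (pp. 125–130)] [cite: BrunsHerzog1998, §1.3 Prop. 1.3.1 and Cor. 1.3.2 (pp. 16–17)] [cite: EGAIII2, (7.7.6)] -/
theorem finrank_HOne_baseChangeComplex_residueField_eq_finrank_cotangentSpace [IsNoetherianRing R]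
    (K : CochainComplex (ModuleCat.{u} R) ℤ) (hfree : ∀ i, Module.Free R (K.X i)) (hfin : ∀ i, Module.Finite R (K.X i))
    (ε : (K.X 0 →ₗ[R] R) →ₗ[R] ResidueField R) (hε : Function.Surjective ε)
    (h₁ : Function.Exact (LinearMap.lcomp R R (K.d 0 1).hom) ε) (h₂ : (homComplex K R).ExactAt (-1)) :
    Module.finrank (ResidueField R)
        ↥((LinearMap.ker ((baseChangeComplex (ResidueField R) K).d 1 2).hom).map
          (LinearMap.range ((baseChangeComplex (ResidueField R) K).d 0 1).hom).mkQ) =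
      Module.finrank (ResidueField R) (CotangentSpace R) := by
  haveI := hfree 0; haveI := hfin 0; haveI := hfree 1; haveI := hfin 1; haveI := hfree 2; haveI := hfin 2
  -- exactness of the dual at `-1`, in map form
  have h₂' : Function.Exact (LinearMap.lcomp R R (K.d 1 2).hom) (LinearMap.lcomp R R (K.d 0 1).hom) := by
    have := ((homComplex K R).exactAt_iff' (-2) (-1) 0 (by simp) (by simp)).1 h₂
    rw [CategoryTheory.ShortComplex.ShortExact.moduleCat_exact_iff_function_exact] at this
    exact this
  -- the `k`-linear identifications and the two commuting squares
  obtain ⟨E₀, hE₀⟩ := exists_residueField_tensor_linearEquiv_homDual (R := R) (K.X 0)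
  obtain ⟨E₁, hE₁⟩ := exists_residueField_tensor_linearEquiv_homDual (R := R) (K.X 1)
  obtain ⟨E₂, hE₂⟩ := exists_residueField_tensor_linearEquiv_homDual (R := R) (K.X 2)
  have sq : ∀ (i j : ℤ) (Ei : (ResidueField R ⊗[R] K.X i) ≃ₗ[ResidueField R] ((K.X i →ₗ[R] R) →ₗ[R] ResidueField R))
      (Ej : (ResidueField R ⊗[R] K.X j) ≃ₗ[ResidueField R] ((K.X j →ₗ[R] R) →ₗ[R] ResidueField R)),
      (∀ c x ψ, Ei (c ⊗ₜ x) ψ = ψ x • c) → (∀ c x ψ, Ej (c ⊗ₜ x) ψ = ψ x • c) →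
      ∀ z, Ej (((baseChangeComplex (ResidueField R) K).d i j).hom z) =
        LinearMap.lcomp (ResidueField R) (ResidueField R) (LinearMap.lcomp R R (K.d i j).hom) (Ei z) := by
    intro i j Ei Ej hEi hEj z
    have hd : ∀ z : ResidueField R ⊗[R] K.X i,
        ((baseChangeComplex (ResidueField R) K).d i j).hom z = ((K.d i j).hom.lTensor (ResidueField R)) z := fun _ => rfl
    rw [hd]
    induction z using TensorProduct.induction_on with
    | zero => simp only [map_zero]
    | tmul c x =>
      ext ψ
      rw [LinearMap.lTensor_tmul, hEj, LinearMap.lcomp_apply, hEi, LinearMap.lcomp_apply]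
    | add z z' hz hz' => simp only [map_add, hz, hz']
  obtain ⟨e⟩ := nonempty_HOne_linearEquiv_of_comm
    ((baseChangeComplex (ResidueField R) K).d 0 1).hom ((baseChangeComplex (ResidueField R) K).d 1 2).hom
    (LinearMap.lcomp (ResidueField R) (ResidueField R) (LinearMap.lcomp R R (K.d 0 1).hom))
    (LinearMap.lcomp (ResidueField R) (ResidueField R) (LinearMap.lcomp R R (K.d 1 2).hom))
    E₀ E₁ E₂ (sq 0 1 E₀ E₁ hE₀ hE₁) (sq 1 2 E₁ E₂ hE₁ hE₂)
  rw [e.finrank_eq]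
  exact finrank_extOne_eq_finrank_cotangentSpace (LinearMap.lcomp R R (K.d 1 2).hom) (LinearMap.lcomp R R (K.d 0 1).hom)
    ε hε h₁ h₂'

end ResidueField

/-! ## §4 EGA III (7.7.6): `Hom_R(Q, M) ≅ H⁰(M ⊗_R K•)` naturally in `M`, `Q = coker(Hom(K¹,R) → Hom(K⁰,R))` -/

section Representability

variable {R : Type u} [CommRing R] (K : CochainComplex (ModuleCat.{u} R) ℤ)
  [Module.Free R (K.X 0)] [Module.Finite R (K.X 0)] [Module.Free R (K.X 1)] [Module.Finite R (K.X 1)]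

/-- **REPRESENTABILITY OF `M ↦ H⁰(M ⊗_R K•)` ([EGAIII2] (7.7.6); [MumfordAV1970] §13).**  Let `K⁰ → K¹` be the first
differential of a cochain complex of `R`-modules with `K⁰`, `K¹` FINITE FREE, and `Q := coker(Hom_R(K¹, R) → Hom_R(K⁰, R))`
(the cokernel of the dual differential; `= H⁰(Hom_R(K•, R))` when `K⁻¹ = 0`).  Then for every `R`-module `M` there is an
`R`-linear isomorphism `Φ_M : Hom_R(Q, M) ≃ ker(M ⊗ K⁰ → M ⊗ K¹)` (`= H⁰(M ⊗_R K•)` when `K⁻¹ = 0`), CHARACTERISED by the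
contraction formula `⟨ψ, Φ_M(φ)⟩ = φ[ψ]` for `ψ ∈ Hom_R(K⁰, R)` (contract `Φ_M(φ) ∈ M ⊗ K⁰` against `ψ` into `M ⊗ R = M`), and
NATURAL in `M`: `Φ_{M′}(g ∘ φ) = (g ⊗ 1)(Φ_M(φ))` for `g : M → M′`.  (§2 `δ : Hom_R(Hom_R(Kⁱ,R), M) ≅ M ⊗ Kⁱ` for `i = 0, 1`
intertwines precomposition with the dual differential and `M ⊗ d`; maps out of the cokernel are the maps killing the image.)
[cite: EGAIII2, (7.7.6)] [cite: MumfordAV1970, §13 (pp. 125–130)] -/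
theorem exists_homCokerDual_linearEquiv_HZero_natural :
    ∃ Φ : ∀ M : ModuleCat.{u} R,
        ((((K.X 0 →ₗ[R] R) ⧸ LinearMap.range (LinearMap.lcomp R R (K.d 0 1).hom)) →ₗ[R] M) ≃ₗ[R]
          ↥(LinearMap.ker ((K.d 0 1).hom.lTensor M))),
      (∀ (M : ModuleCat.{u} R) (φ : ((K.X 0 →ₗ[R] R) ⧸ LinearMap.range (LinearMap.lcomp R R (K.d 0 1).hom)) →ₗ[R] M)
          (ψ : K.X 0 →ₗ[R] R),
          TensorProduct.rid R M (ψ.lTensor M ((Φ M φ : ↥(LinearMap.ker ((K.d 0 1).hom.lTensor M))) : M ⊗[R] K.X 0)) =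
            φ (Submodule.Quotient.mk ψ)) ∧
      (∀ (M M' : ModuleCat.{u} R) (g : M →ₗ[R] M')
          (φ : ((K.X 0 →ₗ[R] R) ⧸ LinearMap.range (LinearMap.lcomp R R (K.d 0 1).hom)) →ₗ[R] M),
          ((Φ M' (g ∘ₗ φ) : ↥(LinearMap.ker ((K.d 0 1).hom.lTensor M'))) : M' ⊗[R] K.X 0) =
            g.rTensor (K.X 0) ((Φ M φ : ↥(LinearMap.ker ((K.d 0 1).hom.lTensor M))) : M ⊗[R] K.X 0)) := by
  classical
  -- the normalised double-dual isomorphisms in degrees 0 and 1, for every `M`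
  choose δ₀ hδ₀ using fun M : ModuleCat.{u} R => exists_homDual_linearEquiv_tensor (R := R) (K.X 0) M
  choose δ₁ hδ₁ using fun M : ModuleCat.{u} R => exists_homDual_linearEquiv_tensor (R := R) (K.X 1) M
  set N := LinearMap.range (LinearMap.lcomp R R (K.d 0 1).hom) with hN
  -- the square: `δ₁ (φ ∘ d^∨) = (M ⊗ d) (δ₀ φ)`
  have sq : ∀ (M : ModuleCat.{u} R) (φ : (K.X 0 →ₗ[R] R) →ₗ[R] M),
      (K.d 0 1).hom.lTensor M (δ₀ M φ) = δ₁ M (φ ∘ₗ LinearMap.lcomp R R (K.d 0 1).hom) := by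
    intro M φ
    have key : ∀ z : M ⊗[R] K.X 0,
        (δ₁ M).symm ((K.d 0 1).hom.lTensor M z) = (δ₀ M).symm z ∘ₗ LinearMap.lcomp R R (K.d 0 1).hom := by
      intro z
      induction z using TensorProduct.induction_on with
      | zero => simp only [map_zero, LinearMap.zero_comp]
      | tmul m x =>
        ext ψ
        rw [LinearMap.lTensor_tmul, hδ₁, LinearMap.comp_apply, hδ₀, LinearMap.lcomp_apply]
      | add z z' hz hz' => simp only [map_add, hz, hz', LinearMap.add_comp]
    have := key (δ₀ M φ)
    rw [LinearEquiv.symm_apply_apply] at this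
    rw [← this, LinearEquiv.apply_symm_apply]
  -- contraction against `ψ` recovers `δ₀⁻¹`
  have contr : ∀ (M : ModuleCat.{u} R) (z : M ⊗[R] K.X 0) (ψ : K.X 0 →ₗ[R] R),
      TensorProduct.rid R M (ψ.lTensor M z) = (δ₀ M).symm z ψ := by
    intro M z ψ
    induction z using TensorProduct.induction_on with
    | zero => simp only [map_zero, LinearMap.zero_apply]
    | tmul m x => rw [LinearMap.lTensor_tmul, TensorProduct.rid_tmul, hδ₀]
    | add z z' hz hz' => simp only [map_add, hz, hz', LinearMap.add_apply]
  -- naturality of `δ₀` in `M`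
  have nat : ∀ (M M' : ModuleCat.{u} R) (g : M →ₗ[R] M') (φ : (K.X 0 →ₗ[R] R) →ₗ[R] M),
      δ₀ M' (g ∘ₗ φ) = g.rTensor (K.X 0) (δ₀ M φ) := by
    intro M M' g φ
    have key : ∀ z : M ⊗[R] K.X 0, (δ₀ M').symm (g.rTensor (K.X 0) z) = g ∘ₗ (δ₀ M).symm z := by
      intro z
      induction z using TensorProduct.induction_on with
      | zero => simp only [map_zero, LinearMap.comp_zero]
      | tmul m x =>
        ext ψ
        rw [LinearMap.rTensor_tmul, hδ₀, LinearMap.comp_apply, hδ₀, map_smul]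
      | add z z' hz hz' => simp only [map_add, hz, hz', LinearMap.comp_add]
    have := key (δ₀ M φ)
    rw [LinearEquiv.symm_apply_apply] at this
    rw [← this, LinearEquiv.apply_symm_apply]
  -- the map `Φ_M φ := δ₀ (φ ∘ mkQ)` lands in the kernel
  have hmem : ∀ (M : ModuleCat.{u} R) (φ : ((K.X 0 →ₗ[R] R) ⧸ N) →ₗ[R] M),
      δ₀ M (φ ∘ₗ N.mkQ) ∈ LinearMap.ker ((K.d 0 1).hom.lTensor M) := by
    intro M φ
    rw [LinearMap.mem_ker, sq, LinearMap.comp_assoc]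
    have : N.mkQ ∘ₗ LinearMap.lcomp R R (K.d 0 1).hom = 0 := by
      ext ψ
      simp only [LinearMap.comp_apply, Submodule.mkQ_apply, LinearMap.zero_apply, Submodule.Quotient.mk_eq_zero, hN]
      exact ⟨ψ, rfl⟩
    rw [this, LinearMap.comp_zero, map_zero]
  let Φ₀ : ∀ M : ModuleCat.{u} R,
      (((K.X 0 →ₗ[R] R) ⧸ N) →ₗ[R] M) →ₗ[R] ↥(LinearMap.ker ((K.d 0 1).hom.lTensor M)) := fun M =>
    LinearMap.codRestrict _ ((δ₀ M : ((K.X 0 →ₗ[R] R) →ₗ[R] M) →ₗ[R] M ⊗[R] K.X 0) ∘ₗ LinearMap.lcomp R M N.mkQ) (hmem M)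
  have hΦ₀ : ∀ (M : ModuleCat.{u} R) φ, (Φ₀ M φ : M ⊗[R] K.X 0) = δ₀ M (φ ∘ₗ N.mkQ) := fun M φ => rfl
  have hbij : ∀ M : ModuleCat.{u} R, Function.Bijective (Φ₀ M) := by
    intro M
    constructor
    · intro φ φ' h
      have h' : δ₀ M (φ ∘ₗ N.mkQ) = δ₀ M (φ' ∘ₗ N.mkQ) := by rw [← hΦ₀, ← hΦ₀, h]
      exact LinearMap.ext fun q => by
        obtain ⟨ψ, rfl⟩ := N.mkQ_surjective q
        exact LinearMap.congr_fun ((δ₀ M).injective h') ψ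
    · rintro ⟨z, hz⟩
      rw [LinearMap.mem_ker] at hz
      have hkill : N ≤ LinearMap.ker ((δ₀ M).symm z) := by
        rintro _ ⟨ψ', rfl⟩
        rw [LinearMap.mem_ker]
        have h0 : (δ₀ M).symm z ∘ₗ LinearMap.lcomp R R (K.d 0 1).hom = 0 := by
          apply (δ₁ M).injective
          rw [← sq, LinearEquiv.apply_symm_apply, hz, map_zero]
        exact LinearMap.congr_fun h0 ψ'
      refine ⟨N.liftQ ((δ₀ M).symm z) hkill, Subtype.ext ?_⟩
      rw [hΦ₀, N.liftQ_mkQ, LinearEquiv.apply_symm_apply]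
  refine ⟨fun M => LinearEquiv.ofBijective (Φ₀ M) (hbij M), fun M φ ψ => ?_, fun M M' g φ => ?_⟩
  · rw [LinearEquiv.ofBijective_apply, hΦ₀, contr, LinearEquiv.symm_apply_apply, LinearMap.comp_apply, Submodule.mkQ_apply]
  · rw [LinearEquiv.ofBijective_apply, LinearEquiv.ofBijective_apply, hΦ₀, hΦ₀, ← nat, LinearMap.comp_assoc]

end Representability

end Literature.Algebra.Homology
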